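import Literature.Analysis.FluidPDE.CKNLocalRegularityRRS
import Literature.Analysis.FluidPDE.CKNInterpolationEstimate
import HarnessLib

/-!
# Caffarelli–Kohn–Nirenberg's first local regularity theorem (RRS form): Step 3 of the induction

Analysis/FluidPDE file in the decomposition of the named facts
`Literature.Analysis.FluidPDE.lemarieRieusset_epsilon_regularity` (Lemarié-Rieusset 2016,
Thm. 14.4) and `Literature.Analysis.FluidPDE.oneScaleRegularity`, continuing
`CKNLocalRegularityRRS` (Robinson–Rodrigo–Sadowski 2016, Thm. 15.3: the setting
`RRS2016.IsSuitablePair`, the bounds `HypA`/`HypB`, the printed Lemmas 15.11–15.12 as named facts,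
Steps 1 and 4 and the induction proved, Steps 2 and 3 as the decomposition targets
`RRS2016.step2_force`, `RRS2016.step3`).

This file **proves Step 3**: `RRS2016.step3_of : interpolationEstimate → lemma15_12 → step3`,
hence (the interpolation inequality, Lemma 15.10, being the accepted and discharged
`interpolationEstimate_holds`) `RRS2016.step3_of_lemma15_12 : lemma15_12 → step3`, and the
assembly of Thm. 15.3 with force from Step 2 and Lemma 15.12 alone,
`RRS2016.theorem15_3_force_of_step2 : step2_force → lemma15_12 → theorem15_3_force`.

## The proof (RRS pp. 223–225, with repair 2 of `CKNLocalRegularityRRS`)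

Fix `C_B ≥ 1`, the constants `C₀` (interpolation) and `C₂` (Lemma 15.12), `c₀ = C₀ + 1`,
`K₁ = 32 c₀ C_B² + 1024`, `K = K₁ + 2(64 C_B² + 4096) + 32`, and
`ε₁ = min(1/(4 c₀ C_B²), 3/(4 C₂ K))³`. Let `0 < ε₀ ≤ ε₁`, `m = ε₀^{1/3}` (so `m ≤ 1/(4c₀C_B²)` and
`m ≤ 3/(4C₂K)`), `z = (s, a) ∈ Q_{1/2}(z₀)`, `n ≥ 2`, `r_n = 2^{-n}`, `ρ = r_n^{1/2}`, and assume
`(B_k)` at `z` for `2 ≤ k ≤ n` and `∫∫_{Q_1(z₀)} (|u|³ + |p|^{3/2}) ≤ ε₀`.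

* *Velocity.* For `2 ≤ k ≤ n`, interpolation on `Q_{r_k}(z) ⊆ Q_1(z₀)` and `(B_k)` give
  `C(r_k) ≤ C₀ (C_B m² r_k²)^{3/2} ≤ c₀ C_B² m³ r_k³` (`C_B^{3/2} ≤ C_B²`); at `k = n` this is
  `≤ m² r_n³ / 4` ((15.25)).
* *Pressure.* Lemma 15.12 on `Q_{1/2}(z)` with `r = r_n ≤ 1/4` bounds, for a.e.
  `t ∈ (s - r_n², s)`, `∫_{B_{r_n}} |p - (p)_{r_n}|^{3/2}` by
  `C₂ ∫_{B_{r_{n-1}}} |u(t)|³ + C₂ r_n^{9/2} T(t)^{3/2} + C₂ 2^{9/2} r_n^{9/2} W(t)`,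
  `T(t) = ∫_{r_{n-1} < |y-a| < 1/2} |u(t)|²/|y-a|⁴`, `W(t) = ∫_{B_{1/2}(a)} (|u(t)|³ + |p(t)|^{3/2})`.
  The annulus is the union of the rings `{r_{j+1} ≤ |y-a| < r_j}`, `1 ≤ j ≤ n - 2`
  (`annulus_subset_iUnion_rings`); on the `j`-th ring the weight is `≤ r_{j+1}⁻⁴` and, for
  `j ≥ 2`, `(B_j)` gives `∫_{B_{r_j}} |u(t)|² ≤ C_B m² r_j³` for a.e. `t`, so these rings contribute
  `≤ 8 C_B m² Σ_j 2^{j+1} ≤ 8 C_B m² / r_n`; the outermost ring `j = 1` contributes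
  `≤ 256 ∫_{B_{1/2}} |u(t)|²`. Hence
  `T^{3/2} ≤ 2((8C_Bm²/r_n)^{3/2} + 4096 (∫_{B_{1/2}}|u(t)|²)^{3/2}) ≤ 2(64 C_B² m³ ρ⁻³ + 4096 W(t))`
  (`(8C_B)^{3/2} ≤ 64 C_B²`; Hölder `(∫_{B_{1/2}}|u|²)^{3/2} ≤ |B_{1/2}|^{1/2} ∫_{B_{1/2}}|u|³ ≤ W`).
  Integrating over `t ∈ (s - r_n², s)` (Tonelli): `∫∫ |u|³` over `(s-r_n²,s) × B_{r_{n-1}}` is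
  `≤ ∫∫_{Q_{r_{n-1}}(z)} |u|³ = r_{n-1}² C(r_{n-1}) ≤ 32 c₀ C_B² m³ r_n⁵` for `n ≥ 3` and `≤ ε₀ = m³`
  `= 1024 m³ r_2⁵` for `n = 2`; `∫ W dt ≤ ε₀`; the constant term picks up `|(s-r_n²,s)| = r_n²`.
  Altogether `∫∫_{Q_{r_n}} |p - (p)_{r_n}|^{3/2} ≤ C₂ K m³ ρ⁹`, i.e.
  `r_n^{1/2} · r_n⁻² ∫∫ … ≤ C₂ K m³ r_n³ ≤ (3/4) m² r_n³` ((15.26)).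
* Sum: `(A_n)`.

## References

* J. C. Robinson, J. L. Rodrigo, W. Sadowski, *The three-dimensional Navier–Stokes equations*,
  Cambridge Studies in Advanced Mathematics 157 (2016): proof of Thm. 15.3, Step 3
  (pp. 223–225), Lemma 15.10, Lemma 15.12 (pp. 232–234). [RobinsonRodrigoSadowski2016]
-/

noncomputable section

open MeasureTheory Set Function Filter Topology TopologicalSpace Metric
open scoped NNReal ENNReal InnerProductSpace RealInnerProductSpace Laplacian

namespace Literature.Analysis.FluidPDE

namespace RRS2016

/-! ### Step 3: helper lemmas -/

section Step3Helpers

/-- Integrating a slice-wise bound over a parabolic cylinder: if for a.e. `t ∈ (s - r², s)`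
`∫_{B_r(a)} g(t, ·) ≤ h(t)`, then `∫∫_{Q_r(z)} g ≤ ∫_{(s - r², s)} h` (Tonelli). [folklore] -/
theorem lintegral_parabolicCylinder_le_of_ae_slice {r : ℝ} {z : ℝ × (EuclideanSpace ℝ (Fin 3))} {g : ℝ × (EuclideanSpace ℝ (Fin 3)) → ℝ≥0∞}
    (hg : AEMeasurable g (volume.restrict (parabolicCylinder r z))) {h : ℝ → ℝ≥0∞}
    (hle : ∀ᵐ t ∂(volume.restrict (Ioo (z.1 - r ^ 2) z.1)), ∫⁻ x in ball z.2 r, g (t, x) ≤ h t) :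
    ∫⁻ w in parabolicCylinder r z, g w ≤ ∫⁻ t in Ioo (z.1 - r ^ 2) z.1, h t := by
  rw [volume_restrict_parabolicCylinder] at hg ⊢
  rw [lintegral_prod _ hg]
  exact lintegral_mono_ae hle

/-- Iterated slice integrals over a product set inside `S` are dominated by the integral over
`S`: `∫_{t ∈ I} ∫_{x ∈ B} g(t, x) ≤ ∫∫_S g` for `I × B ⊆ S`. [folklore] -/
theorem lintegral_lintegral_le_of_prod_subset {I : Set ℝ} {B : Set (EuclideanSpace ℝ (Fin 3))} {S : Set (ℝ × (EuclideanSpace ℝ (Fin 3)))}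
    (hsub : I ×ˢ B ⊆ S) {g : ℝ × (EuclideanSpace ℝ (Fin 3)) → ℝ≥0∞}
    (hg : AEMeasurable g (volume.restrict S)) :
    ∫⁻ t in I, ∫⁻ x in B, g (t, x) ≤ ∫⁻ w in S, g w := by
  have hg' : AEMeasurable g ((volume.restrict I).prod (volume.restrict B)) := by
    rw [Measure.prod_restrict, ← Measure.volume_eq_prod]
    exact hg.mono_measure (Measure.restrict_mono hsub le_rfl)
  rw [← lintegral_prod _ hg', Measure.prod_restrict, ← Measure.volume_eq_prod]
  exact lintegral_mono_set hsub

/-- The volume of the ball of radius `1/2` in `ℝ³` is at most `1` (`|B_{1/2}| = π/6`). [folklore] -/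
theorem volume_ball_half_le_one (a : (EuclideanSpace ℝ (Fin 3))) : volume (ball a (1 / 2 : ℝ)) ≤ 1 := by
  rw [EuclideanSpace.volume_ball_fin_three, ← ENNReal.ofReal_pow (by norm_num),
    ← ENNReal.ofReal_mul (by norm_num), ← ENNReal.ofReal_one]
  refine ENNReal.ofReal_le_ofReal ?_
  nlinarith [Real.pi_lt_four]

/-- Hölder on `B_{1/2}(a)`: `(∫_{B_{1/2}} F²)^{3/2} ≤ ∫_{B_{1/2}} F³` (since `|B_{1/2}| ≤ 1`). [folklore] -/
theorem lintegral_sq_rpow_le_lintegral_cube (a : (EuclideanSpace ℝ (Fin 3))) {F : (EuclideanSpace ℝ (Fin 3)) → ℝ≥0∞}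
    (hF : AEMeasurable F (volume.restrict (ball a (1 / 2)))) :
    (∫⁻ x in ball a (1 / 2), F x ^ 2) ^ (3 / 2 : ℝ) ≤ ∫⁻ x in ball a (1 / 2), F x ^ (3 : ℕ) := by
  have H := setLIntegral_rpow_le_rpow_mul_measure volume (ball a (1 / 2)) hF (a := 2) (b := 3)
    (by norm_num) (by norm_num)
  have e2 : ∀ x, F x ^ (2 : ℝ) = F x ^ 2 := fun x => by
    rw [show (2 : ℝ) = ((2 : ℕ) : ℝ) by norm_num, ENNReal.rpow_natCast]
  have e3 : ∀ x, F x ^ (3 : ℝ) = F x ^ (3 : ℕ) := fun x => by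
    rw [show (3 : ℝ) = ((3 : ℕ) : ℝ) by norm_num, ENNReal.rpow_natCast]
  simp only [e2, e3] at H
  calc (∫⁻ x in ball a (1 / 2), F x ^ 2) ^ (3 / 2 : ℝ)
      ≤ ((∫⁻ x in ball a (1 / 2), F x ^ (3 : ℕ)) ^ ((2 : ℝ) / 3) *
          volume (ball a (1 / 2)) ^ (1 - (2 : ℝ) / 3)) ^ (3 / 2 : ℝ) := ENNReal.rpow_le_rpow H (by norm_num)
    _ = (∫⁻ x in ball a (1 / 2), F x ^ (3 : ℕ)) * volume (ball a (1 / 2)) ^ (1 / 2 : ℝ) := by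
        rw [ENNReal.mul_rpow_of_nonneg _ _ (by norm_num), ← ENNReal.rpow_mul, ← ENNReal.rpow_mul]
        norm_num
    _ ≤ (∫⁻ x in ball a (1 / 2), F x ^ (3 : ℕ)) * 1 := by
        gcongr
        exact ENNReal.rpow_le_one (volume_ball_half_le_one a) (by norm_num)
    _ = _ := mul_one _

/-- The dyadic ring decomposition of the annulus `{r_{n-1} < |y - a| < 1/2}`: every point lies in
one of the rings `{r_{j+1} ≤ |y - a| < r_j}`, `1 ≤ j ≤ n - 2`. [folklore] -/
theorem annulus_subset_iUnion_rings (a : (EuclideanSpace ℝ (Fin 3))) {n : ℕ} (hn : 2 ≤ n) :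
    {y : (EuclideanSpace ℝ (Fin 3)) | rad (n - 1) < dist y a ∧ dist y a < 1 / 2} ⊆
      ⋃ j : ↥(Finset.Ico 1 (n - 1)),
        {y : (EuclideanSpace ℝ (Fin 3)) | rad ((j : ℕ) + 1) ≤ dist y a ∧ dist y a < rad (j : ℕ)} := by
  intro y hy
  obtain ⟨hy1, hy2⟩ := hy
  -- the predicate `P m : rad (m + 1) ≤ dist y a` holds at `m = n - 2`
  have hP : ∃ m : ℕ, rad (m + 1) ≤ dist y a := ⟨n - 2, by
    rw [show n - 2 + 1 = n - 1 by omega]; exact hy1.le⟩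
  classical
  set j := Nat.find hP with hj
  have hj1 : rad (j + 1) ≤ dist y a := Nat.find_spec hP
  have hjle : j ≤ n - 2 := Nat.find_le (by rw [show n - 2 + 1 = n - 1 by omega]; exact hy1.le)
  have hj0 : j ≠ 0 := by
    intro h0
    rw [h0] at hj1
    rw [zero_add, rad_one] at hj1
    linarith
  have hj2 : dist y a < rad j := by
    have := Nat.find_min hP (m := j - 1) (by omega)
    rw [show j - 1 + 1 = j by omega] at this
    exact lt_of_not_ge this
  refine mem_iUnion.2 ⟨⟨j, Finset.mem_Ico.2 ⟨by omega, by omega⟩⟩, hj1, hj2⟩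


/-- Geometric sum bound for the ring decomposition: `Σ_{2 ≤ j < N} 2^{j+1} ≤ 2^{N+1}`. [folklore] -/
theorem sum_Ico_two_pow_succ_le (N : ℕ) :
    ∑ j ∈ Finset.Ico 2 N, (2 : ℝ) ^ (j + 1) ≤ 2 ^ (N + 1) := by
  induction N with
  | zero => simp
  | succ N ih =>
      rcases Nat.lt_or_ge N 2 with hN | hN
      · have : Finset.Ico 2 (N + 1) = ∅ := Finset.Ico_eq_empty_of_le (by omega)
        rw [this, Finset.sum_empty]; positivity
      · rw [Finset.sum_Ico_succ_top hN]
        have h2 : (2 : ℝ) ^ (N + 1 + 1) = 2 ^ (N + 1) + 2 ^ (N + 1) := by ring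
        linarith [ih, h2]

/-- The time–space average of the pressure slice is (a.e. strongly) measurable on the cylinder. [folklore] -/
theorem aestronglyMeasurable_setAverage_fst {r : ℝ} {z : ℝ × (EuclideanSpace ℝ (Fin 3))} {p : ℝ → (EuclideanSpace ℝ (Fin 3)) → ℝ}
    (hp : AEStronglyMeasurable (uncurry p) (volume.restrict (parabolicCylinder r z))) :
    AEStronglyMeasurable (fun w : ℝ × (EuclideanSpace ℝ (Fin 3)) => ⨍ y in ball z.2 r, p w.1 y)
      (volume.restrict (parabolicCylinder r z)) := by
  rw [volume_restrict_parabolicCylinder] at hp ⊢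
  have h1 : AEStronglyMeasurable (fun t => ∫ y, p t y ∂(volume.restrict (ball z.2 r)))
      (volume.restrict (Ioo (z.1 - r ^ 2) z.1)) := hp.integral_prod_right'
  have h2 : AEStronglyMeasurable (fun t => ⨍ y in ball z.2 r, p t y)
      (volume.restrict (Ioo (z.1 - r ^ 2) z.1)) := by
    have : (fun t => ⨍ y in ball z.2 r, p t y) =
        fun t => (volume.real (ball z.2 r))⁻¹ • ∫ y, p t y ∂(volume.restrict (ball z.2 r)) := by
      funext t; rw [setAverage_eq]
    rw [this]
    exact (aestronglyMeasurable_const (b := (volume.real (ball z.2 r))⁻¹)).smul h1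
  exact h2.comp_quasiMeasurePreserving (Measure.quasiMeasurePreserving_fst
    (μ := volume.restrict (Ioo (z.1 - r ^ 2) z.1)) (ν := volume.restrict (ball z.2 r)))

/-- The dyadic rings are measurable. [folklore] -/
theorem measurableSet_ring (a : (EuclideanSpace ℝ (Fin 3))) (r r' : ℝ) :
    MeasurableSet {y : (EuclideanSpace ℝ (Fin 3)) | r ≤ dist y a ∧ dist y a < r'} :=
  (measurableSet_le measurable_const (continuous_id.dist continuous_const).measurable).inter
    (measurableSet_lt (continuous_id.dist continuous_const).measurable measurable_const)

/-- On the ring `{r_{j+1} ≤ |y - a| < r_j}` the weight `|y - a|⁻⁴` is at most `r_{j+1}⁻⁴`, so the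
weighted energy of the ring is at most `r_{j+1}⁻⁴ ∫_{B_{r_j}(a)} |u(t)|²`. [folklore] -/
theorem lintegral_ring_weight_le (a : (EuclideanSpace ℝ (Fin 3))) (j : ℕ) (v : (EuclideanSpace ℝ (Fin 3)) → (EuclideanSpace ℝ (Fin 3))) :
    ∫⁻ y in {y : (EuclideanSpace ℝ (Fin 3)) | rad (j + 1) ≤ dist y a ∧ dist y a < rad j},
        ‖v y‖ₑ ^ 2 / ENNReal.ofReal (dist y a ^ 4) ≤
      (ENNReal.ofReal (rad (j + 1) ^ 4))⁻¹ * ∫⁻ y in ball a (rad j), ‖v y‖ₑ ^ 2 := by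
  rw [← lintegral_const_mul' _ _ (ENNReal.inv_ne_top.2 (ENNReal.ofReal_pos.2
    (pow_pos (rad_pos _) 4)).ne')]
  calc ∫⁻ y in {y : (EuclideanSpace ℝ (Fin 3)) | rad (j + 1) ≤ dist y a ∧ dist y a < rad j},
          ‖v y‖ₑ ^ 2 / ENNReal.ofReal (dist y a ^ 4)
      ≤ ∫⁻ y in {y : (EuclideanSpace ℝ (Fin 3)) | rad (j + 1) ≤ dist y a ∧ dist y a < rad j},
          (ENNReal.ofReal (rad (j + 1) ^ 4))⁻¹ * ‖v y‖ₑ ^ 2 := by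
        refine setLIntegral_mono' (measurableSet_ring a _ _) fun y hy => ?_
        have hinv : (ENNReal.ofReal (dist y a ^ 4))⁻¹ ≤ (ENNReal.ofReal (rad (j + 1) ^ 4))⁻¹ :=
          ENNReal.inv_le_inv' (ENNReal.ofReal_le_ofReal (pow_le_pow_left₀ (rad_pos _).le hy.1 4))
        calc ‖v y‖ₑ ^ 2 / ENNReal.ofReal (dist y a ^ 4)
            = ‖v y‖ₑ ^ 2 * (ENNReal.ofReal (dist y a ^ 4))⁻¹ := div_eq_mul_inv _ _
          _ ≤ ‖v y‖ₑ ^ 2 * (ENNReal.ofReal (rad (j + 1) ^ 4))⁻¹ := by gcongr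
          _ = _ := mul_comm _ _
    _ ≤ ∫⁻ y in ball a (rad j), (ENNReal.ofReal (rad (j + 1) ^ 4))⁻¹ * ‖v y‖ₑ ^ 2 :=
        lintegral_mono_set fun y hy => mem_ball.2 hy.2

/-- The ring decomposition of the tail term, integrated: for `n ≥ 2`,
`∫_{r_{n-1} < |y-a| < 1/2} |v|²/|y-a|⁴ ≤ Σ_{1 ≤ j ≤ n-2} ∫_{ring_j} |v|²/|y-a|⁴`. [folklore] -/
theorem lintegral_annulus_le_sum_rings (a : (EuclideanSpace ℝ (Fin 3))) {n : ℕ} (hn : 2 ≤ n) (v : (EuclideanSpace ℝ (Fin 3)) → (EuclideanSpace ℝ (Fin 3))) :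
    ∫⁻ y in {y : (EuclideanSpace ℝ (Fin 3)) | rad (n - 1) < dist y a ∧ dist y a < 1 / 2},
        ‖v y‖ₑ ^ 2 / ENNReal.ofReal (dist y a ^ 4) ≤
      ∑ j ∈ Finset.Ico 1 (n - 1), ∫⁻ y in {y : (EuclideanSpace ℝ (Fin 3)) | rad (j + 1) ≤ dist y a ∧ dist y a < rad j},
        ‖v y‖ₑ ^ 2 / ENNReal.ofReal (dist y a ^ 4) := by
  calc ∫⁻ y in {y : (EuclideanSpace ℝ (Fin 3)) | rad (n - 1) < dist y a ∧ dist y a < 1 / 2},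
          ‖v y‖ₑ ^ 2 / ENNReal.ofReal (dist y a ^ 4)
      ≤ ∫⁻ y in ⋃ j : ↥(Finset.Ico 1 (n - 1)),
          {y : (EuclideanSpace ℝ (Fin 3)) | rad ((j : ℕ) + 1) ≤ dist y a ∧ dist y a < rad (j : ℕ)},
          ‖v y‖ₑ ^ 2 / ENNReal.ofReal (dist y a ^ 4) :=
        lintegral_mono_set (annulus_subset_iUnion_rings a hn)
    _ ≤ ∑' j : ↥(Finset.Ico 1 (n - 1)),
          ∫⁻ y in {y : (EuclideanSpace ℝ (Fin 3)) | rad ((j : ℕ) + 1) ≤ dist y a ∧ dist y a < rad (j : ℕ)},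
            ‖v y‖ₑ ^ 2 / ENNReal.ofReal (dist y a ^ 4) := lintegral_iUnion_le _ _
    _ = _ := by
        rw [tsum_fintype]
        exact Finset.sum_coe_sort (Finset.Ico 1 (n - 1)) (fun j : ℕ =>
          ∫⁻ y in {y : (EuclideanSpace ℝ (Fin 3)) | rad (j + 1) ≤ dist y a ∧ dist y a < rad j},
            ‖v y‖ₑ ^ 2 / ENNReal.ofReal (dist y a ^ 4))

end Step3Helpers

/-! ### Step 3 from the interpolation inequality and the local pressure estimate -/

/-- `∫∫_{Q_r(z)} |u|³ = r² · C(r)` (`cknC` unscaled), for `r > 0`. [folklore] -/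
theorem lintegral_cube_eq_mul_cknC {r : ℝ} (hr : 0 < r) (z : ℝ × (EuclideanSpace ℝ (Fin 3))) (u : ℝ → (EuclideanSpace ℝ (Fin 3)) → (EuclideanSpace ℝ (Fin 3))) :
    ∫⁻ w in parabolicCylinder r z, ‖u w.1 w.2‖ₑ ^ (3 : ℕ) =
      ENNReal.ofReal r ^ 2 * cknC r z u := by
  have h0 : ENNReal.ofReal r ^ 2 ≠ 0 := pow_ne_zero _ (ENNReal.ofReal_pos.2 hr).ne'
  have htop : ENNReal.ofReal r ^ 2 ≠ ∞ := ENNReal.pow_ne_top ENNReal.ofReal_ne_top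
  rw [cknC, ← mul_assoc, ENNReal.mul_inv_cancel h0 htop, one_mul]

set_option maxHeartbeats 1600000 in
/-- **Step 3 of the induction, proved** from the interpolation inequality (Lemma 15.10, the
accepted `interpolationEstimate`) and the slice-wise local pressure estimate (`lemma15_12`),
following RRS pp. 223–225 with the outermost ring of the tail handled by Hölder in time (module
docstring, repair 2). Constants: with `c₀ = C₀ + 1`, `K = 32 c₀ C_B² + 1024 + 2(64 C_B² + 4096) + 32`,
the threshold is `ε₁(C_B) = min(1/(4 c₀ C_B²), 3/(4 C₂ K))³`. [cite: RobinsonRodrigoSadowski2016, proof of Thm. 15.3, Step 3, pp. 223–225] -/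
theorem step3_of (hI : interpolationEstimate) (h12 : lemma15_12) : step3 := by
  obtain ⟨C₀, HC₀⟩ := hI
  obtain ⟨C₂, hC₂, H12⟩ := h12
  intro CB hCB
  have hCB0 : 0 < CB := lt_of_lt_of_le one_pos hCB
  -- constants
  set c₀ : ℝ := (C₀ : ℝ) + 1 with hc₀
  have hc₀0 : 0 < c₀ := by positivity
  have hC₀c₀ : (C₀ : ℝ) ≤ c₀ := by simp [hc₀]
  set K₁ : ℝ := 32 * c₀ * CB ^ 2 + 1024 with hK₁
  set K : ℝ := K₁ + 2 * (64 * CB ^ 2 + 4096) + 32 with hK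
  have hK₁0 : 0 < K₁ := by positivity
  have hK0 : 0 < K := by positivity
  set δ : ℝ := min (1 / (4 * c₀ * CB ^ 2)) (3 / (4 * C₂ * K)) with hδ
  have hδ0 : 0 < δ := lt_min (by positivity) (by positivity)
  refine ⟨δ ^ 3, by positivity, ?_⟩
  intro z₀ ν f u p G hS ε₀ hε₀ hε₀₁ hsmall z hz n hn hBk
  -- real parameters `m = ε₀^{1/3}`, `ρ = r_n^{1/2}`
  set m : ℝ := ε₀ ^ (1 / 3 : ℝ) with hm
  have hm0 : 0 < m := Real.rpow_pos_of_pos hε₀ _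
  have hm3 : m ^ 3 = ε₀ := by
    rw [hm, ← Real.rpow_natCast, ← Real.rpow_mul hε₀.le]; norm_num
  have hm2 : ε₀ ^ (2 / 3 : ℝ) = m ^ 2 := by
    rw [hm, ← Real.rpow_natCast, ← Real.rpow_mul hε₀.le]; norm_num
  have hmδ : m ≤ δ := by
    refine le_of_pow_le_pow_left₀ (n := 3) (by norm_num) hδ0.le ?_
    rw [hm3]; exact hε₀₁
  have hm_u : m ≤ 1 / (4 * c₀ * CB ^ 2) := hmδ.trans (min_le_left _ _)
  have hm_p : m ≤ 3 / (4 * C₂ * K) := hmδ.trans (min_le_right _ _)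
  set rn : ℝ := rad n with hrn
  have hrn0 : 0 < rn := rad_pos n
  have hrn4 : rn ≤ 1 / 4 := by rw [hrn, ← rad_two]; exact rad_antitone hn
  have hrn1 : rn ≤ 1 := by linarith
  set ρ : ℝ := Real.sqrt rn with hρ
  have hρ0 : 0 < ρ := Real.sqrt_pos.2 hrn0
  have hρ2 : ρ ^ 2 = rn := Real.sq_sqrt hrn0.le
  have hρ1 : ρ ≤ 1 := by
    rw [hρ, ← Real.sqrt_one]; exact Real.sqrt_le_sqrt hrn1
  have hrn_half : rn ^ (1 / 2 : ℝ) = ρ := by rw [hρ, Real.sqrt_eq_rpow]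
  have hrn_92 : rn ^ (9 / 2 : ℝ) = ρ ^ 9 := by
    rw [← hρ2, ← Real.rpow_natCast ρ 2, ← Real.rpow_mul hρ0.le, ← Real.rpow_natCast ρ 9]
    norm_num
  have hrad_pred : rad (n - 1) = 2 * rn := by
    have : rad n = rad (n - 1 + 1) := by rw [Nat.sub_add_cancel (by omega)]
    rw [hrn, this, rad_succ]; ring
  -- geometry and measurability
  have hzQ : ∀ {r : ℝ}, 0 < r → r ≤ 1 / 2 → parabolicCylinder r z ⊆ parabolicCylinder 1 z₀ :=
    fun hr hr2 => parabolicCylinder_subset_of_mem_half hz hr hr2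
  have hu1 : AEStronglyMeasurable (uncurry u) (volume.restrict (parabolicCylinder 1 z₀)) :=
    hS.weakGradient.locallyIntegrableOn.aestronglyMeasurable
  have hp1 : AEStronglyMeasurable (uncurry p) (volume.restrict (parabolicCylinder 1 z₀)) :=
    hS.pressure_locallyIntegrableOn.aestronglyMeasurable
  have hres : ∀ {r : ℝ}, 0 < r → r ≤ 1 / 2 →
      volume.restrict (parabolicCylinder r z) ≤ volume.restrict (parabolicCylinder 1 z₀) :=
    fun hr hr2 => Measure.restrict_mono (hzQ hr hr2) le_rfl
  have huh : AEStronglyMeasurable (uncurry u) (volume.restrict (parabolicCylinder (1 / 2) z)) :=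
    hu1.mono_measure (hres (by norm_num) le_rfl)
  have hph : AEStronglyMeasurable (uncurry p) (volume.restrict (parabolicCylinder (1 / 2) z)) :=
    hp1.mono_measure (hres (by norm_num) le_rfl)
  -- (1) the velocity bounds `C(r_k) ≤ c₀ C_B² m³ r_k³` from `(B_k)` and interpolation
  have hCk : ∀ k, 2 ≤ k → k ≤ n →
      cknC (rad k) z u ≤ ENNReal.ofReal (c₀ * CB ^ 2 * m ^ 3 * (rad k) ^ 3) := by
    intro k hk2 hkn
    have hBkk := hBk k hk2 hkn
    have hle : parabolicCylinderOpens (rad k) z ≤ parabolicCylinderOpens 1 z₀ :=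
      parabolicCylinder_rad_subset hz (by omega)
    have hG := hS.weakGradient.mono hle
    have hfinA : cknAEss (rad k) z u ≠ ∞ :=
      ne_top_of_le_ne_top ENNReal.ofReal_ne_top (le_trans le_self_add hBkk)
    have hfinE : cknE (rad k) z G ≠ ∞ :=
      ne_top_of_le_ne_top ENNReal.ofReal_ne_top (le_trans le_add_self hBkk)
    have h1 := HC₀ u G z (rad k) (rad_pos k) hG hfinA hfinE
    have hreal : (C₀ : ℝ) * (CB * ε₀ ^ (2 / 3 : ℝ) * rad k ^ 2) ^ (3 / 2 : ℝ) ≤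
        c₀ * CB ^ 2 * m ^ 3 * rad k ^ 3 := by
      have e1 : (CB * ε₀ ^ (2 / 3 : ℝ) * rad k ^ 2) ^ (3 / 2 : ℝ) =
          CB ^ (3 / 2 : ℝ) * m ^ 3 * rad k ^ 3 := by
        rw [hm2, Real.mul_rpow (by positivity) (by positivity),
          Real.mul_rpow (by positivity) (by positivity)]
        congr 1
        · congr 1
          rw [← Real.rpow_natCast m 2, ← Real.rpow_mul hm0.le, ← Real.rpow_natCast m 3]
          norm_num
        · rw [← Real.rpow_natCast (rad k) 2, ← Real.rpow_mul (rad_pos k).le,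
            ← Real.rpow_natCast (rad k) 3]
          norm_num
      have e2 : CB ^ (3 / 2 : ℝ) ≤ CB ^ 2 := by
        rw [← Real.rpow_natCast CB 2]
        exact Real.rpow_le_rpow_of_exponent_le hCB (by norm_num)
      rw [e1]
      have hx : 0 ≤ CB ^ (3 / 2 : ℝ) * m ^ 3 * rad k ^ 3 :=
        mul_nonneg (mul_nonneg (Real.rpow_nonneg hCB0.le _) (pow_pos hm0 3).le)
          (pow_pos (rad_pos k) 3).le
      calc (C₀ : ℝ) * (CB ^ (3 / 2 : ℝ) * m ^ 3 * rad k ^ 3)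
          ≤ c₀ * (CB ^ 2 * m ^ 3 * rad k ^ 3) :=
            mul_le_mul hC₀c₀ (mul_le_mul_of_nonneg_right
              (mul_le_mul_of_nonneg_right e2 (pow_pos hm0 3).le) (pow_pos (rad_pos k) 3).le)
              hx hc₀0.le
        _ = _ := by ring
    calc cknC (rad k) z u ≤ C₀ * (cknAEss (rad k) z u + cknE (rad k) z G) ^ (3 / 2 : ℝ) := h1
      _ ≤ C₀ * (ENNReal.ofReal (CB * ε₀ ^ (2 / 3 : ℝ) * rad k ^ 2)) ^ (3 / 2 : ℝ) := by
          gcongr; exact hBkk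
      _ = ENNReal.ofReal ((C₀ : ℝ) * (CB * ε₀ ^ (2 / 3 : ℝ) * rad k ^ 2) ^ (3 / 2 : ℝ)) := by
          rw [ENNReal.ofReal_mul (NNReal.coe_nonneg _), ENNReal.ofReal_coe_nnreal,
            ENNReal.ofReal_rpow_of_nonneg (by positivity) (by norm_num)]
      _ ≤ ENNReal.ofReal (c₀ * CB ^ 2 * m ^ 3 * (rad k) ^ 3) := ENNReal.ofReal_le_ofReal hreal
  -- (2) the slice energy bounds from `(B_j)`
  have hslice : ∀ᵐ t : ℝ, ∀ j : ℕ, 2 ≤ j → j ≤ n → t ∈ Ioo (z.1 - rad j ^ 2) z.1 →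
      ∫⁻ x in ball z.2 (rad j), ‖u t x‖ₑ ^ 2 ≤ ENNReal.ofReal (CB * m ^ 2 * rad j ^ 3) := by
    refine ae_all_iff.2 fun j => ?_
    by_cases hj : 2 ≤ j ∧ j ≤ n
    · have hBj := hBk j hj.1 hj.2
      have hA : cknAEss (rad j) z u ≤ ENNReal.ofReal (CB * m ^ 2 * rad j ^ 2) := by
        rw [← hm2]; exact le_trans le_self_add hBj
      filter_upwards [ae_ball_sq_le_of_cknAEss_le (rad_pos j) hA] with t ht _ _ htI using ht htI
    · exact ae_of_all _ fun t h1 h2 => absurd ⟨h1, h2⟩ hj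
  -- (3) Lemma 15.12 on `Q_{1/2}(z)` with `r = r_n`
  have hU3 : ∫⁻ w in parabolicCylinder (1 / 2) z, ‖u w.1 w.2‖ₑ ^ (3 : ℕ) < ∞ :=
    lt_of_le_of_lt ((lintegral_mono fun w => le_self_add).trans
      ((lintegral_mono_set (hzQ (by norm_num) le_rfl)).trans hsmall)) ENNReal.ofReal_lt_top
  have hP32 : ∫⁻ w in parabolicCylinder (1 / 2) z, ‖p w.1 w.2‖ₑ ^ (3 / 2 : ℝ) < ∞ :=
    lt_of_le_of_lt ((lintegral_mono fun w => le_add_self).trans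
      ((lintegral_mono_set (hzQ (by norm_num) le_rfl)).trans hsmall)) ENNReal.ofReal_lt_top
  have hleh : parabolicCylinderOpens (1 / 2) z ≤ parabolicCylinderOpens 1 z₀ :=
    hzQ (by norm_num) le_rfl
  have h12ae := H12 z (1 / 2) u p (by norm_num) huh hph hU3 hP32 (hS.mono hleh).pressureEq
    rn hrn0 (by linarith)
  -- the time interval of `Q_{r_n}(z)` and the slices of `u` on `B_{1/2}(a)`
  set In : Set ℝ := Ioo (z.1 - rn ^ 2) z.1 with hIn
  have hInsub : In ⊆ Ioo (z.1 - (1 / 2) ^ 2) z.1 := Ioo_subset_Ioo (by nlinarith) le_rfl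
  have hslm : ∀ᵐ t ∂(volume.restrict (Ioo (z.1 - (1 / 2) ^ 2) z.1)),
      AEStronglyMeasurable (fun x => u t x) (volume.restrict (ball z.2 (1 / 2))) := by
    have huh' : AEStronglyMeasurable (uncurry u)
        ((volume.restrict (Ioo (z.1 - (1 / 2) ^ 2) z.1)).prod (volume.restrict (ball z.2 (1 / 2)))) := by
      rw [← volume_restrict_parabolicCylinder]; exact huh
    filter_upwards [huh'.prodMk_left] with t ht using ht
  -- (4) the slice-wise bound on `(s - r_n², s)`
  have h22 : (2 : ℝ≥0∞) ^ ((3 / 2 : ℝ) - 1) ≤ 2 := by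
    conv_rhs => rw [← ENNReal.rpow_one 2]
    exact ENNReal.rpow_le_rpow_of_exponent_le (by norm_num) (by norm_num)
  have h256 : (256 : ℝ≥0∞) ^ (3 / 2 : ℝ) = 4096 := by
    rw [show (256 : ℝ≥0∞) = ENNReal.ofReal 256 by norm_num,
      ENNReal.ofReal_rpow_of_pos (by norm_num), show (256 : ℝ) = 16 ^ 2 by norm_num,
      ← Real.rpow_natCast 16 2, ← Real.rpow_mul (by norm_num)]
    norm_num
  have hA32 : ENNReal.ofReal (8 * CB * m ^ 2 / rn) ^ (3 / 2 : ℝ) ≤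
      ENNReal.ofReal (64 * CB ^ 2 * m ^ 3 / ρ ^ 3) := by
    rw [ENNReal.ofReal_rpow_of_nonneg (by positivity) (by norm_num)]
    refine ENNReal.ofReal_le_ofReal ?_
    set lam : ℝ := Real.sqrt (8 * CB) with hlam
    have hlam2 : lam ^ 2 = 8 * CB := Real.sq_sqrt (by positivity)
    have hlam1 : 1 ≤ lam := by
      rw [hlam, Real.one_le_sqrt]; linarith
    have e : 8 * CB * m ^ 2 / rn = (lam * m / ρ) ^ 2 := by
      rw [div_pow, mul_pow, hlam2, hρ2]
    rw [e, ← Real.rpow_natCast _ 2, ← Real.rpow_mul (by positivity),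
      show ((2 : ℕ) : ℝ) * (3 / 2) = ((3 : ℕ) : ℝ) by norm_num, Real.rpow_natCast, div_pow, mul_pow]
    have hlam3 : lam ^ 3 ≤ 64 * CB ^ 2 := by
      have h1 : lam ≤ lam ^ 2 := le_self_pow₀ hlam1 two_ne_zero
      have h2 : lam ^ 3 = 8 * CB * lam := by rw [pow_succ, hlam2]
      rw [h2]
      have h3 : lam ≤ 8 * CB := by rw [← hlam2]; exact h1
      nlinarith
    have hρ3 : 0 < ρ ^ 3 := by positivity
    exact div_le_div_of_nonneg_right (mul_le_mul_of_nonneg_right hlam3 (pow_pos hm0 3).le)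
      hρ3.le
  have hkey : ∀ᵐ t ∂(volume.restrict In),
      ∫⁻ x in ball z.2 rn, ‖p t x - ⨍ y in ball z.2 rn, p t y‖ₑ ^ (3 / 2 : ℝ) ≤
        ENNReal.ofReal C₂ * (∫⁻ x in ball z.2 (2 * rn), ‖u t x‖ₑ ^ (3 : ℕ)) +
        ENNReal.ofReal C₂ * ENNReal.ofReal (ρ ^ 9) *
          (2 * ENNReal.ofReal (64 * CB ^ 2 * m ^ 3 / ρ ^ 3)) +
        ENNReal.ofReal C₂ * ENNReal.ofReal (ρ ^ 9) * (2 * 4096 + 32) *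
          ∫⁻ x in ball z.2 (1 / 2), (‖u t x‖ₑ ^ (3 : ℕ) + ‖p t x‖ₑ ^ (3 / 2 : ℝ)) := by
    have hslice' : ∀ᵐ t ∂(volume.restrict In), ∀ j : ℕ, 2 ≤ j → j ≤ n →
        t ∈ Ioo (z.1 - rad j ^ 2) z.1 →
        ∫⁻ x in ball z.2 (rad j), ‖u t x‖ₑ ^ 2 ≤ ENNReal.ofReal (CB * m ^ 2 * rad j ^ 3) :=
      ae_restrict_of_ae hslice
    filter_upwards [ae_restrict_of_ae_restrict_of_subset hInsub h12ae, hslice',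
      ae_restrict_of_ae_restrict_of_subset hInsub hslm, ae_restrict_mem measurableSet_Ioo]
      with t h12t hslt hmt htIn
    set E : ℝ≥0∞ := ∫⁻ x in ball z.2 (1 / 2), ‖u t x‖ₑ ^ 2 with hE
    set W : ℝ≥0∞ := ∫⁻ x in ball z.2 (1 / 2), (‖u t x‖ₑ ^ (3 : ℕ) + ‖p t x‖ₑ ^ (3 / 2 : ℝ)) with hW
    -- slices at time `t` inherit the bounds `(B_j)`, `2 ≤ j ≤ n`
    have hballj : ∀ j, 2 ≤ j → j ≤ n →
        ∫⁻ x in ball z.2 (rad j), ‖u t x‖ₑ ^ 2 ≤ ENNReal.ofReal (CB * m ^ 2 * rad j ^ 3) := by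
      intro j hj2 hjn
      refine hslt j hj2 hjn ⟨?_, htIn.2⟩
      have : rn ≤ rad j := rad_antitone hjn
      have h1 := htIn.1
      nlinarith [rad_pos j]
    -- the tail: rings `2 ≤ j ≤ n - 2` by `(B_j)`, the outermost ring by the energy on `B_{1/2}`
    have hT : ∫⁻ y in {y : (EuclideanSpace ℝ (Fin 3)) | 2 * rn < dist y z.2 ∧ dist y z.2 < 1 / 2},
        ‖u t y‖ₑ ^ 2 / ENNReal.ofReal (dist y z.2 ^ 4) ≤
        ENNReal.ofReal (8 * CB * m ^ 2 / rn) + 256 * E := by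
      rw [← hrad_pred]
      refine (lintegral_annulus_le_sum_rings z.2 hn (u t)).trans ?_
      rcases Nat.lt_or_ge 1 (n - 1) with h1n | h1n
      · rw [Finset.sum_eq_sum_Ico_succ_bot h1n]
        have hring1 : ∫⁻ y in {y : (EuclideanSpace ℝ (Fin 3)) | rad (1 + 1) ≤ dist y z.2 ∧ dist y z.2 < rad 1},
            ‖u t y‖ₑ ^ 2 / ENNReal.ofReal (dist y z.2 ^ 4) ≤ 256 * E := by
          refine (lintegral_ring_weight_le z.2 1 (u t)).trans ?_
          rw [rad_one, show (1 : ℕ) + 1 = 2 from rfl, rad_two]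
          have : (ENNReal.ofReal ((1 / 4 : ℝ) ^ 4))⁻¹ = 256 := by
            rw [← ENNReal.ofReal_inv_of_pos (by norm_num)]; norm_num
          rw [this]
        have hrings : ∑ j ∈ Finset.Ico 2 (n - 1),
            ∫⁻ y in {y : (EuclideanSpace ℝ (Fin 3)) | rad (j + 1) ≤ dist y z.2 ∧ dist y z.2 < rad j},
              ‖u t y‖ₑ ^ 2 / ENNReal.ofReal (dist y z.2 ^ 4) ≤
            ENNReal.ofReal (8 * CB * m ^ 2 / rn) := by
          calc ∑ j ∈ Finset.Ico 2 (n - 1),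
                ∫⁻ y in {y : (EuclideanSpace ℝ (Fin 3)) | rad (j + 1) ≤ dist y z.2 ∧ dist y z.2 < rad j},
                  ‖u t y‖ₑ ^ 2 / ENNReal.ofReal (dist y z.2 ^ 4)
              ≤ ∑ j ∈ Finset.Ico 2 (n - 1), ENNReal.ofReal (8 * CB * m ^ 2 * 2 ^ (j + 1)) := by
                refine Finset.sum_le_sum fun j hj => ?_
                obtain ⟨hj2, hjn⟩ := Finset.mem_Ico.1 hj
                refine (lintegral_ring_weight_le z.2 j (u t)).trans ?_
                calc (ENNReal.ofReal (rad (j + 1) ^ 4))⁻¹ * ∫⁻ y in ball z.2 (rad j), ‖u t y‖ₑ ^ 2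
                    ≤ (ENNReal.ofReal (rad (j + 1) ^ 4))⁻¹ * ENNReal.ofReal (CB * m ^ 2 * rad j ^ 3) := by
                      gcongr
                      exact hballj j hj2 (by omega)
                  _ = ENNReal.ofReal (8 * CB * m ^ 2 * 2 ^ (j + 1)) := by
                      rw [← ENNReal.ofReal_inv_of_pos (pow_pos (rad_pos _) 4),
                        ← ENNReal.ofReal_mul (inv_nonneg.2 (pow_nonneg (rad_pos _).le 4))]
                      congr 1
                      have hr := rad_pos j
                      have hinv : (rad j)⁻¹ = 2 ^ j := by rw [rad, ← inv_pow]; norm_num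
                      have e1 : ((rad (j + 1)) ^ 4)⁻¹ * (CB * m ^ 2 * rad j ^ 3) =
                          16 * CB * m ^ 2 * (rad j)⁻¹ := by
                        rw [rad_succ]; field_simp; ring
                      rw [e1, hinv, pow_succ]; ring
            _ = ENNReal.ofReal (∑ j ∈ Finset.Ico 2 (n - 1), 8 * CB * m ^ 2 * 2 ^ (j + 1)) :=
                (ENNReal.ofReal_sum_of_nonneg (fun j _ => by positivity)).symm
            _ ≤ ENNReal.ofReal (8 * CB * m ^ 2 / rn) := by
                refine ENNReal.ofReal_le_ofReal ?_
                rw [← Finset.mul_sum]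
                have hs := sum_Ico_two_pow_succ_le (n - 1)
                rw [Nat.sub_add_cancel (by omega)] at hs
                have h2n : (2 : ℝ) ^ n = 1 / rn := by
                  rw [hrn, rad, one_div, ← inv_pow, one_div, inv_inv]
                rw [h2n] at hs
                calc 8 * CB * m ^ 2 * ∑ j ∈ Finset.Ico 2 (n - 1), (2 : ℝ) ^ (j + 1)
                    ≤ 8 * CB * m ^ 2 * (1 / rn) := by gcongr
                  _ = 8 * CB * m ^ 2 / rn := by ring
        calc _ ≤ 256 * E + ENNReal.ofReal (8 * CB * m ^ 2 / rn) := add_le_add hring1 hrings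
          _ = _ := add_comm _ _
      · have : Finset.Ico 1 (n - 1) = ∅ := Finset.Ico_eq_empty_of_le h1n
        rw [this, Finset.sum_empty]
        exact zero_le
    -- `(256 E)^{3/2} ≤ 4096 ∫_{B_{1/2}} |u(t)|³ ≤ 4096 W`
    have hE32 : (256 * E) ^ (3 / 2 : ℝ) ≤ 4096 * W := by
      rw [ENNReal.mul_rpow_of_nonneg _ _ (by norm_num), h256]
      gcongr
      calc E ^ (3 / 2 : ℝ) ≤ ∫⁻ x in ball z.2 (1 / 2), ‖u t x‖ₑ ^ (3 : ℕ) :=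
            lintegral_sq_rpow_le_lintegral_cube z.2 hmt.enorm
        _ ≤ W := lintegral_mono fun x => le_self_add
    have hT32 : (∫⁻ y in {y : (EuclideanSpace ℝ (Fin 3)) | 2 * rn < dist y z.2 ∧ dist y z.2 < 1 / 2},
        ‖u t y‖ₑ ^ 2 / ENNReal.ofReal (dist y z.2 ^ 4)) ^ (3 / 2 : ℝ) ≤
        2 * (ENNReal.ofReal (64 * CB ^ 2 * m ^ 3 / ρ ^ 3) + 4096 * W) := by
      calc _ ≤ (ENNReal.ofReal (8 * CB * m ^ 2 / rn) + 256 * E) ^ (3 / 2 : ℝ) :=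
            ENNReal.rpow_le_rpow hT (by norm_num)
        _ ≤ 2 ^ ((3 / 2 : ℝ) - 1) * (ENNReal.ofReal (8 * CB * m ^ 2 / rn) ^ (3 / 2 : ℝ) +
              (256 * E) ^ (3 / 2 : ℝ)) := ENNReal.rpow_add_le_mul_rpow_add_rpow _ _ (by norm_num)
        _ ≤ 2 * (ENNReal.ofReal (64 * CB ^ 2 * m ^ 3 / ρ ^ 3) + 4096 * W) := by
            gcongr
    -- the third coefficient: `r_n^{9/2} / (1/2)^{9/2} ≤ 32 ρ⁹`
    have hcoef3 : ENNReal.ofReal (rn ^ (9 / 2 : ℝ) / (1 / 2 : ℝ) ^ (9 / 2 : ℝ)) ≤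
        ENNReal.ofReal (ρ ^ 9) * 32 := by
      rw [show (32 : ℝ≥0∞) = ENNReal.ofReal 32 by norm_num, ← ENNReal.ofReal_mul (by positivity)]
      refine ENNReal.ofReal_le_ofReal ?_
      rw [hrn_92]
      have h32 : (1 / 32 : ℝ) ≤ (1 / 2 : ℝ) ^ (9 / 2 : ℝ) := by
        have : (1 / 2 : ℝ) ^ (5 : ℝ) ≤ (1 / 2 : ℝ) ^ (9 / 2 : ℝ) :=
          Real.rpow_le_rpow_of_exponent_ge (by norm_num) (by norm_num) (by norm_num)
        refine le_trans (le_of_eq ?_) this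
        rw [show (5 : ℝ) = ((5 : ℕ) : ℝ) by norm_num, Real.rpow_natCast]; norm_num
      rw [div_le_iff₀ (lt_of_lt_of_le (by norm_num) h32)]
      have hρ9 : 0 ≤ ρ ^ 9 := by positivity
      nlinarith
    have hcoef2 : ENNReal.ofReal (rn ^ (9 / 2 : ℝ)) = ENNReal.ofReal (ρ ^ 9) := by rw [hrn_92]
    -- assemble the slice bound
    calc ∫⁻ x in ball z.2 rn, ‖p t x - ⨍ y in ball z.2 rn, p t y‖ₑ ^ (3 / 2 : ℝ)
        ≤ ENNReal.ofReal C₂ * (∫⁻ x in ball z.2 (2 * rn), ‖u t x‖ₑ ^ (3 : ℕ)) +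
          ENNReal.ofReal C₂ * ENNReal.ofReal (rn ^ (9 / 2 : ℝ)) *
            (∫⁻ y in {y : (EuclideanSpace ℝ (Fin 3)) | 2 * rn < dist y z.2 ∧ dist y z.2 < 1 / 2},
              ‖u t y‖ₑ ^ 2 / ENNReal.ofReal (dist y z.2 ^ 4)) ^ (3 / 2 : ℝ) +
          ENNReal.ofReal C₂ * ENNReal.ofReal (rn ^ (9 / 2 : ℝ) / (1 / 2 : ℝ) ^ (9 / 2 : ℝ)) * W :=
          h12t
      _ ≤ ENNReal.ofReal C₂ * (∫⁻ x in ball z.2 (2 * rn), ‖u t x‖ₑ ^ (3 : ℕ)) +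
          ENNReal.ofReal C₂ * ENNReal.ofReal (ρ ^ 9) *
            (2 * (ENNReal.ofReal (64 * CB ^ 2 * m ^ 3 / ρ ^ 3) + 4096 * W)) +
          ENNReal.ofReal C₂ * (ENNReal.ofReal (ρ ^ 9) * 32) * W := by
          rw [hcoef2]
          gcongr
      _ = _ := by ring
  -- (5) integrate the slice bound over `(s - r_n², s)`
  have hmeasOsc : AEMeasurable
      (fun w : ℝ × (EuclideanSpace ℝ (Fin 3)) => ‖p w.1 w.2 - ⨍ y in ball z.2 rn, p w.1 y‖ₑ ^ (3 / 2 : ℝ))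
      (volume.restrict (parabolicCylinder rn z)) := by
    have hprn : AEStronglyMeasurable (uncurry p) (volume.restrict (parabolicCylinder rn z)) :=
      hp1.mono_measure (hres hrn0 (by linarith))
    exact ((hprn.sub (aestronglyMeasurable_setAverage_fst hprn)).enorm.pow_const _)
  have hU2meas : AEMeasurable (fun t => ∫⁻ x in ball z.2 (2 * rn), ‖u t x‖ₑ ^ (3 : ℕ))
      (volume.restrict In) := by
    have hsub : In ×ˢ ball z.2 (2 * rn) ⊆ parabolicCylinder 1 z₀ := by
      refine subset_trans ?_ (hzQ (r := 2 * rn) (by positivity) (by linarith))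
      exact prod_mono (Ioo_subset_Ioo (by nlinarith) le_rfl) Subset.rfl
    have h1 : AEMeasurable (fun w : ℝ × (EuclideanSpace ℝ (Fin 3)) => ‖u w.1 w.2‖ₑ ^ (3 : ℕ))
        ((volume.restrict In).prod (volume.restrict (ball z.2 (2 * rn)))) := by
      rw [Measure.prod_restrict, ← Measure.volume_eq_prod]
      exact (hu1.mono_measure (Measure.restrict_mono hsub le_rfl)).enorm.pow_const _
    exact h1.lintegral_prod_right'
  have hWmeas : AEMeasurable
      (fun t => ∫⁻ x in ball z.2 (1 / 2), (‖u t x‖ₑ ^ (3 : ℕ) + ‖p t x‖ₑ ^ (3 / 2 : ℝ)))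
      (volume.restrict In) := by
    have hsub : In ×ˢ ball z.2 (1 / 2) ⊆ parabolicCylinder 1 z₀ :=
      subset_trans (prod_mono hInsub Subset.rfl) (hzQ (by norm_num) le_rfl)
    have h1 : AEMeasurable (fun w : ℝ × (EuclideanSpace ℝ (Fin 3)) => ‖u w.1 w.2‖ₑ ^ (3 : ℕ) + ‖p w.1 w.2‖ₑ ^ (3 / 2 : ℝ))
        ((volume.restrict In).prod (volume.restrict (ball z.2 (1 / 2)))) := by
      rw [Measure.prod_restrict, ← Measure.volume_eq_prod]
      exact ((hu1.mono_measure (Measure.restrict_mono hsub le_rfl)).enorm.pow_const _).add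
        ((hp1.mono_measure (Measure.restrict_mono hsub le_rfl)).enorm.pow_const _)
    exact h1.lintegral_prod_right'
  -- the three integrated pieces
  have hInt1 : ∫⁻ t in In, ∫⁻ x in ball z.2 (2 * rn), ‖u t x‖ₑ ^ (3 : ℕ) ≤
      ENNReal.ofReal (K₁ * m ^ 3 * rn ^ 5) := by
    have hsub : In ×ˢ ball z.2 (2 * rn) ⊆ parabolicCylinder (rad (n - 1)) z := by
      rw [hrad_pred]
      refine prod_mono (Ioo_subset_Ioo (by nlinarith) le_rfl) Subset.rfl
    have hmeas : AEMeasurable (fun w : ℝ × (EuclideanSpace ℝ (Fin 3)) => ‖u w.1 w.2‖ₑ ^ (3 : ℕ))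
        (volume.restrict (parabolicCylinder (rad (n - 1)) z)) :=
      (hu1.mono_measure (hres (rad_pos _) (by rw [hrad_pred]; linarith))).enorm.pow_const _
    refine (lintegral_lintegral_le_of_prod_subset hsub hmeas).trans ?_
    rcases Nat.lt_or_ge 2 n with h3n | h2n
    · -- `n ≥ 3`: use `C(r_{n-1})`
      rw [lintegral_cube_eq_mul_cknC (rad_pos _)]
      calc ENNReal.ofReal (rad (n - 1)) ^ 2 * cknC (rad (n - 1)) z u
          ≤ ENNReal.ofReal (rad (n - 1)) ^ 2 *
              ENNReal.ofReal (c₀ * CB ^ 2 * m ^ 3 * rad (n - 1) ^ 3) := by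
            gcongr
            exact hCk (n - 1) (by omega) (by omega)
        _ = ENNReal.ofReal (32 * c₀ * CB ^ 2 * m ^ 3 * rn ^ 5) := by
            rw [← ENNReal.ofReal_pow (rad_pos _).le, ← ENNReal.ofReal_mul (by positivity),
              hrad_pred]
            congr 1; ring
        _ ≤ ENNReal.ofReal (K₁ * m ^ 3 * rn ^ 5) := by
            refine ENNReal.ofReal_le_ofReal ?_
            rw [hK₁]
            nlinarith [pow_pos hm0 3, pow_pos hrn0 5]
    · -- `n = 2`: use the smallness hypothesis directly
      obtain rfl : n = 2 := le_antisymm h2n hn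
      calc ∫⁻ w in parabolicCylinder (rad (2 - 1)) z, ‖u w.1 w.2‖ₑ ^ (3 : ℕ)
          ≤ ∫⁻ w in parabolicCylinder 1 z₀, (‖u w.1 w.2‖ₑ ^ (3 : ℕ) + ‖p w.1 w.2‖ₑ ^ (3 / 2 : ℝ)) :=
            (lintegral_mono_set (hzQ (rad_pos _) (by rw [show 2 - 1 = 1 from rfl, rad_one]))).trans
              (lintegral_mono fun w => le_self_add)
        _ ≤ ENNReal.ofReal ε₀ := hsmall
        _ ≤ ENNReal.ofReal (K₁ * m ^ 3 * rn ^ 5) := by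
            refine ENNReal.ofReal_le_ofReal ?_
            rw [← hm3, hK₁, hrn, rad_two]
            nlinarith [pow_pos hm0 3, mul_pos hc₀0 (pow_pos hCB0 2)]
  have hInt3 : ∫⁻ t in In, ∫⁻ x in ball z.2 (1 / 2), (‖u t x‖ₑ ^ (3 : ℕ) + ‖p t x‖ₑ ^ (3 / 2 : ℝ)) ≤
      ENNReal.ofReal (m ^ 3) := by
    have hsub : In ×ˢ ball z.2 (1 / 2) ⊆ parabolicCylinder 1 z₀ :=
      subset_trans (prod_mono hInsub Subset.rfl) (hzQ (by norm_num) le_rfl)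
    have hmeas : AEMeasurable (fun w : ℝ × (EuclideanSpace ℝ (Fin 3)) => ‖u w.1 w.2‖ₑ ^ (3 : ℕ) + ‖p w.1 w.2‖ₑ ^ (3 / 2 : ℝ))
        (volume.restrict (parabolicCylinder 1 z₀)) :=
      (hu1.enorm.pow_const _).add (hp1.enorm.pow_const _)
    rw [hm3]
    exact (lintegral_lintegral_le_of_prod_subset hsub hmeas).trans hsmall
  have hvolIn : volume In = ENNReal.ofReal (ρ ^ 4) := by
    rw [hIn, Real.volume_Ioo, ← hρ2]; congr 1; ring
  have hOsc : ∫⁻ w in parabolicCylinder rn z, ‖p w.1 w.2 - ⨍ y in ball z.2 rn, p w.1 y‖ₑ ^ (3 / 2 : ℝ) ≤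
      ENNReal.ofReal (C₂ * K * m ^ 3 * ρ ^ 9) := by
    refine (lintegral_parabolicCylinder_le_of_ae_slice hmeasOsc hkey).trans ?_
    rw [lintegral_add_left' ((hU2meas.const_mul _).add_const _), lintegral_add_left'
      (hU2meas.const_mul _), lintegral_const_mul'' _ hU2meas, lintegral_const,
      Measure.restrict_apply_univ, hvolIn, lintegral_const_mul'' _ hWmeas]
    calc ENNReal.ofReal C₂ * (∫⁻ t in In, ∫⁻ x in ball z.2 (2 * rn), ‖u t x‖ₑ ^ (3 : ℕ)) +
          ENNReal.ofReal C₂ * ENNReal.ofReal (ρ ^ 9) * (2 * ENNReal.ofReal (64 * CB ^ 2 * m ^ 3 / ρ ^ 3)) *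
            ENNReal.ofReal (ρ ^ 4) +
          ENNReal.ofReal C₂ * ENNReal.ofReal (ρ ^ 9) * (2 * 4096 + 32) *
            ∫⁻ t in In, ∫⁻ x in ball z.2 (1 / 2), (‖u t x‖ₑ ^ (3 : ℕ) + ‖p t x‖ₑ ^ (3 / 2 : ℝ))
        ≤ ENNReal.ofReal C₂ * ENNReal.ofReal (K₁ * m ^ 3 * rn ^ 5) +
          ENNReal.ofReal C₂ * ENNReal.ofReal (ρ ^ 9) * (2 * ENNReal.ofReal (64 * CB ^ 2 * m ^ 3 / ρ ^ 3)) *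
            ENNReal.ofReal (ρ ^ 4) +
          ENNReal.ofReal C₂ * ENNReal.ofReal (ρ ^ 9) * (2 * 4096 + 32) * ENNReal.ofReal (m ^ 3) := by
          gcongr
      _ = ENNReal.ofReal (C₂ * (K₁ * m ^ 3 * rn ^ 5) +
            C₂ * ρ ^ 9 * (2 * (64 * CB ^ 2 * m ^ 3 / ρ ^ 3)) * ρ ^ 4 +
            C₂ * ρ ^ 9 * (2 * 4096 + 32) * m ^ 3) := by
          have T1 : ENNReal.ofReal C₂ * ENNReal.ofReal (K₁ * m ^ 3 * rn ^ 5) =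
              ENNReal.ofReal (C₂ * (K₁ * m ^ 3 * rn ^ 5)) := (ENNReal.ofReal_mul hC₂.le).symm
          have T2 : ENNReal.ofReal C₂ * ENNReal.ofReal (ρ ^ 9) *
              (2 * ENNReal.ofReal (64 * CB ^ 2 * m ^ 3 / ρ ^ 3)) * ENNReal.ofReal (ρ ^ 4) =
              ENNReal.ofReal (C₂ * ρ ^ 9 * (2 * (64 * CB ^ 2 * m ^ 3 / ρ ^ 3)) * ρ ^ 4) := by
            rw [show (2 : ℝ≥0∞) = ENNReal.ofReal 2 by norm_num,
              ← ENNReal.ofReal_mul (p := (2 : ℝ)) (by norm_num),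
              ← ENNReal.ofReal_mul (p := C₂) hC₂.le,
              ← ENNReal.ofReal_mul (p := C₂ * ρ ^ 9) (by positivity),
              ← ENNReal.ofReal_mul (p := C₂ * ρ ^ 9 * (2 * (64 * CB ^ 2 * m ^ 3 / ρ ^ 3)))
                (by positivity)]
          have T3 : ENNReal.ofReal C₂ * ENNReal.ofReal (ρ ^ 9) * (2 * 4096 + 32) *
              ENNReal.ofReal (m ^ 3) = ENNReal.ofReal (C₂ * ρ ^ 9 * (2 * 4096 + 32) * m ^ 3) := by
            rw [show (2 * 4096 + 32 : ℝ≥0∞) = ENNReal.ofReal (2 * 4096 + 32) by norm_num,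
              ← ENNReal.ofReal_mul (p := C₂) hC₂.le,
              ← ENNReal.ofReal_mul (p := C₂ * ρ ^ 9) (by positivity),
              ← ENNReal.ofReal_mul (p := C₂ * ρ ^ 9 * (2 * 4096 + 32)) (by positivity)]
          rw [T1, T2, T3, ← ENNReal.ofReal_add (by positivity) (by positivity),
            ← ENNReal.ofReal_add (by positivity) (by positivity)]
      _ ≤ ENNReal.ofReal (C₂ * K * m ^ 3 * ρ ^ 9) := by
          refine ENNReal.ofReal_le_ofReal ?_
          rw [← hρ2, hK]
          have e3 : (ρ ^ 2) ^ 5 = ρ ^ 10 := by ring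
          have e2 : C₂ * ρ ^ 9 * (2 * (64 * CB ^ 2 * m ^ 3 / ρ ^ 3)) * ρ ^ 4 =
              128 * C₂ * CB ^ 2 * m ^ 3 * ρ ^ 10 := by
            have hρ3 : ρ ^ 3 ≠ 0 := by positivity
            field_simp
            ring
          have h2 : ρ ^ 10 ≤ ρ ^ 9 := pow_le_pow_of_le_one hρ0.le hρ1 (by norm_num)
          rw [e2, e3]
          have hA : 0 ≤ C₂ * K₁ * m ^ 3 := by positivity
          have hB : 0 ≤ 128 * C₂ * CB ^ 2 * m ^ 3 := by positivity
          nlinarith [mul_nonneg hA (sub_nonneg.2 h2), mul_nonneg hB (sub_nonneg.2 h2)]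
  -- (6) the pressure part of `(A_n)`
  have hP : ENNReal.ofReal (rn ^ (1 / 2 : ℝ)) * cknDOsc rn z p ≤
      ENNReal.ofReal (3 / 4 * m ^ 2 * rn ^ 3) := by
    rw [cknDOsc, hrn_half]
    have hρ4 : ENNReal.ofReal rn ^ 2 = ENNReal.ofReal (ρ ^ 4) := by
      rw [← ENNReal.ofReal_pow hrn0.le, ← hρ2]; congr 1; ring
    have h0 : ENNReal.ofReal (ρ ^ 4) ≠ 0 := (ENNReal.ofReal_pos.2 (by positivity)).ne'
    calc ENNReal.ofReal ρ * ((ENNReal.ofReal rn ^ 2)⁻¹ *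
          ∫⁻ w in parabolicCylinder rn z, ‖p w.1 w.2 - ⨍ y in ball z.2 rn, p w.1 y‖ₑ ^ (3 / 2 : ℝ))
        ≤ ENNReal.ofReal ρ * ((ENNReal.ofReal rn ^ 2)⁻¹ * ENNReal.ofReal (C₂ * K * m ^ 3 * ρ ^ 9)) := by
          gcongr
      _ = ENNReal.ofReal (C₂ * K * m ^ 3 * ρ ^ 6) := by
          rw [hρ4, show C₂ * K * m ^ 3 * ρ ^ 9 = (C₂ * K * m ^ 3 * ρ ^ 5) * ρ ^ 4 by ring,
            ENNReal.ofReal_mul (by positivity), mul_comm (ENNReal.ofReal (C₂ * K * m ^ 3 * ρ ^ 5)),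
            ← mul_assoc, ← mul_assoc, mul_assoc (ENNReal.ofReal ρ),
            ENNReal.inv_mul_cancel h0 ENNReal.ofReal_ne_top, mul_one,
            ← ENNReal.ofReal_mul hρ0.le]
          congr 1; ring
      _ ≤ ENNReal.ofReal (3 / 4 * m ^ 2 * rn ^ 3) := by
          refine ENNReal.ofReal_le_ofReal ?_
          rw [← hρ2, show (ρ ^ 2) ^ 3 = ρ ^ 6 by ring]
          have hCK : 0 < 4 * C₂ * K := by positivity
          have hm' : C₂ * K * m ≤ 3 / 4 := by
            rw [le_div_iff₀ hCK] at hm_p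
            linarith
          nlinarith [pow_pos hm0 2, pow_pos hρ0 6, mul_pos (pow_pos hm0 2) (pow_pos hρ0 6)]
  -- (7) the velocity part of `(A_n)` and the conclusion
  have hU : cknC rn z u ≤ ENNReal.ofReal (1 / 4 * m ^ 2 * rn ^ 3) := by
    refine (hCk n hn le_rfl).trans (ENNReal.ofReal_le_ofReal ?_)
    have hcc : 0 < 4 * c₀ * CB ^ 2 := by positivity
    have hm' : c₀ * CB ^ 2 * m ≤ 1 / 4 := by
      rw [le_div_iff₀ hcc] at hm_u
      linarith
    nlinarith [pow_pos hm0 2, pow_pos hrn0 3, mul_pos (pow_pos hm0 2) (pow_pos hrn0 3)]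
  unfold HypA
  calc cknC (rad n) z u + ENNReal.ofReal (rad n ^ (1 / 2 : ℝ)) * cknDOsc (rad n) z p
      ≤ ENNReal.ofReal (1 / 4 * m ^ 2 * rn ^ 3) + ENNReal.ofReal (3 / 4 * m ^ 2 * rn ^ 3) :=
        add_le_add hU hP
    _ = ENNReal.ofReal (ε₀ ^ (2 / 3 : ℝ) * rad n ^ 3) := by
        rw [← ENNReal.ofReal_add (by positivity) (by positivity), hm2]
        congr 1; ring


/-- Step 3 from Lemma 15.12 alone, the interpolation inequality (Lemma 15.10) being the
discharged fact `interpolationEstimate_holds`. [cite: RobinsonRodrigoSadowski2016, proof of Thm. 15.3, Step 3, pp. 223–225] -/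
theorem step3_of_lemma15_12 (h12 : lemma15_12) : step3 :=
  step3_of interpolationEstimate_holds h12

/-- **Thm. 15.3 with force, from Step 2 and Lemma 15.12**: the trust base of
`theorem15_3_force` is reduced to `{step2_force, lemma15_12}`. [cite: RobinsonRodrigoSadowski2016, Thm. 15.3 pp. 220–226] -/
theorem theorem15_3_force_of_step2 (h2 : step2_force) (h12 : lemma15_12) : theorem15_3_force :=
  theorem15_3_force_of_steps h2 (step3_of_lemma15_12 h12)

/-- Thm. 15.3 as printed (`f = 0`), from Step 2 and Lemma 15.12. [cite: RobinsonRodrigoSadowski2016, Thm. 15.3 p. 220] -/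
theorem theorem15_3_of_step2 (h2 : step2_force) (h12 : lemma15_12) : theorem15_3 :=
  theorem15_3_of_force (theorem15_3_force_of_step2 h2 h12)

end RRS2016

end Literature.Analysis.FluidPDE
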